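import Literature.MathematicalPhysics.QuantumLattice.GrassmannIntegralBerezinProofs
import HarnessLib

/-!
# Partial Berezin integration: products of monomials, spectators, Fubini

Trunk **QLatticeAQFT**; companion of `GrassmannIntegral.lean`, which defines the partial Berezin
integration `berezinOn R s : GrassmannAlgebra R ι →ₗ[R] GrassmannAlgebra R ι` over the variables
`s : Finset ι` by its action on the monomial basis (`berezinOn_grassmannBasis`:
`θ_t = ε θ_{t∖s} θ_s ↦ ε θ_{t∖s}`, integrated block moved to the right, `ε = berezinSign s t`).
This file supplies the working API of partial integration needed for iterated ("multiscale")
Gaussian Grassmann integrations — integrating out some fields while the others are spectators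
(Benfatto–Giuliani–Mastropietro 2006, §2.2–2.3, (2.12)–(2.13); Salmhofer 1999, App. B.2–B.3).

## Main results (namespace `Literature.MathematicalPhysics.QuantumLattice.GrassmannAlgebra`)

Multiplication table of the monomial basis:
* `gen_mul_grassmannBasis_of_not_mem` / `_of_mem` — `θₐ θ_w = (-1)^{#{b ∈ w | b < a}} θ_{w ∪ {a}}`
  (`a ∉ w`), `θₐ θ_w = 0` (`a ∈ w`);
* `grassmannBasis_mul_grassmannBasis_of_disjoint` / `_of_not_disjoint` —
  `θ_u θ_s = berezinSign s (u ∪ s) • θ_{u ∪ s}` for `u ∩ s = ∅` (the shuffle sign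
  `(-1)^{#{(x,y) ∈ s × u | x < y}}` is exactly the sign in the definition of `berezinOn`), and `0`
  otherwise; `grassmannBasis_eq_smul_sdiff_mul_inter` — `θ_t = ε θ_{t∖s} θ_{t∩s}`.

Partial integration:
* `berezinOn_grassmannBasis_mul_grassmannBasis` — `∫ dθ_s (θ_u θ_m) = [m = s] θ_u` for a spectator
  monomial `θ_u` (`u ∩ s = ∅`) and `m ⊆ s` (sign-free in this convention);
* `spectatorSubalgebra R s` (a `def`: the span of the `θ_u`, `u ∩ s = ∅`, as a subalgebra) with
  `spectatorSubalgebra_eq_adjoin` (`= Algebra.adjoin R {θᵢ | i ∉ s}`),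
  `gen_mem_spectatorSubalgebra`, `grassmannBasis_mem_spectatorSubalgebra`;
* `berezinOn_mul_of_mem_spectatorSubalgebra` — **linearity over spectators**:
  `∫ dθ_s (a x) = a ∫ dθ_s x` for `a ∈ spectatorSubalgebra R s` (and on the right for central `a`,
  `berezinOn_mul_of_mem_spectatorSubalgebra_of_commute`);
* `berezinOn_mul_grassmannBasis_self`, `berezinOn_of_mem_spectatorSubalgebra` —
  `∫ dθ_s (a θ_s) = a`, `∫ dθ_s a = 0` (`s ≠ ∅`) for spectators `a`: partial integration extracts the
  top coefficient in the integrated variables;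
* `berezinOn_berezinOn` — **Fubini**: `∫dθ_s ∫dθ_t = berezinSign t (s ∪ t) • ∫ dθ_{s∪t}` for disjoint
  blocks, sign-free when `s` precedes `t` (`berezinOn_berezinOn_of_forall_lt`), and
  `berezinOn_berezinOn_compl_of_forall_lt` — `∫ dθ = ∫ dθ_s ∫ dθ_{sᶜ}`.

Auxiliary: `sort_eq_sort_filter_lt_append`, `sort_insert_eq_append` (sorted enumerations split
at a point), `gen_mul_prod_map_gen`, `grassmannBasis_insert_of_forall_lt`,
`grassmannBasis_singleton`, `berezinSign_insert_union`, `intCast_berezinSign`,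
`card_filter_fubini`.

## Sources

F. A. Berezin, *The Method of Second Quantization* (Academic Press, 1966), Ch. I §3: the integral
over a Grassmann algebra as the iterate of the single-variable rules `∫ dxᵢ = 0`, `∫ xᵢ dxᵢ = 1`
((3.4)–(3.5)), multilinear over coefficients not involving the integration variables; bib key
`BerezinSecondQuant1966` (not held; as cited in `GrassmannIntegral.lean`).
M. Salmhofer, *Renormalization: An Introduction* (Springer, 1999), App. B.2, PDF p. 176 of the held
copy: (B.26)–(B.28) (multiple integrals as iterated single integrals), and Remark B.8 (PDF p. 178):
"The `φ_{IJ}(f)` may be Grassmann-algebra valued, as long as they are independent of `ψ̄` and `ψ`";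
bib key `Salmhofer1999`.
I. Montvay, G. Münster, *Quantum Fields on a Lattice* (CUP, 1994), §4.1.3 (4.20)–(4.21), PDF
pp. 167–168 of the held copy (the integral over a set of pairs extracts the top coefficient); bib
key `MontvayMunster1994`.
G. Benfatto, A. Giuliani, V. Mastropietro, Ann. Henri Poincaré 7 (2006), §2.2, (2.12) (iterated
Gaussian Grassmann integrations, the "addition principle"), for which this API is preparatory.

## Proofs

`θ_w` is the increasing product of its generators (`grassmannBasis_eq_prod_map_gen`); splitting the
sorted enumeration at `a` and anticommuting `θₐ` through the lower part gives the insertion rule,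
and induction on the minimum of `u` (`Finset.induction_on_min`) gives the product rule with the
sign recursion `berezinSign_insert_union`.  Partial integration of `θ_u θ_m = ε θ_{u∪m}` then follows
from `berezinOn_grassmannBasis` and `ε² = 1`; linearity over spectators is checked on the basis
after splitting `θ_t = ε θ_{t∖s} θ_{t∩s}`; Fubini is the exponent identity `card_filter_fubini`.
-/

noncomputable section

namespace Literature.MathematicalPhysics.QuantumLattice

section QLatticeAQFT

namespace GrassmannAlgebra

open ExteriorAlgebra
open scoped Pointwise

variable (R : Type*) [CommRing R] {ι : Type*} [LinearOrder ι]

/-! ### Sorted enumerations split at a point -/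

omit R in
/-- Splitting the increasing enumeration of `w` at `a ∉ w`. [folklore] -/
theorem sort_eq_sort_filter_lt_append (w : Finset ι) {a : ι} (ha : a ∉ w) :
    w.sort = (w.filter (· < a)).sort ++ (w.filter (a < ·)).sort := by
  refine (Finset.sortedLT_sort w).eq_of_mem_iff ?_ fun x => ?_
  · rw [List.sortedLT_iff_pairwise, List.pairwise_append]
    refine ⟨(Finset.sortedLT_sort _).pairwise, (Finset.sortedLT_sort _).pairwise, ?_⟩
    intro x hx y hy
    rw [Finset.mem_sort, Finset.mem_filter] at hx hy
    exact hx.2.trans hy.2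
  · simp only [List.mem_append, Finset.mem_sort, Finset.mem_filter]
    constructor
    · intro hx
      rcases lt_or_gt_of_ne (fun h => ha (h ▸ hx) : x ≠ a) with h | h
      · exact Or.inl ⟨hx, h⟩
      · exact Or.inr ⟨hx, h⟩
    · rintro (⟨hx, -⟩ | ⟨hx, -⟩) <;> exact hx

omit R in
/-- The increasing enumeration of `insert a w`, `a ∉ w`, is that of `w` with `a` inserted at its
place. [folklore] -/
theorem sort_insert_eq_append (w : Finset ι) {a : ι} (ha : a ∉ w) :
    (insert a w).sort = (w.filter (· < a)).sort ++ a :: (w.filter (a < ·)).sort := by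
  refine (Finset.sortedLT_sort _).eq_of_mem_iff ?_ fun x => ?_
  · rw [List.sortedLT_iff_pairwise, List.pairwise_append, List.pairwise_cons]
    refine ⟨(Finset.sortedLT_sort _).pairwise, ⟨?_, (Finset.sortedLT_sort _).pairwise⟩, ?_⟩
    · intro y hy
      rw [Finset.mem_sort, Finset.mem_filter] at hy
      exact hy.2
    · intro x hx y hy
      rw [Finset.mem_sort, Finset.mem_filter] at hx
      rw [List.mem_cons, Finset.mem_sort, Finset.mem_filter] at hy
      rcases hy with rfl | hy
      · exact hx.2
      · exact hx.2.trans hy.2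
  · simp only [List.mem_append, List.mem_cons, Finset.mem_sort, Finset.mem_filter,
      Finset.mem_insert]
    constructor
    · rintro (rfl | hx)
      · exact Or.inr (Or.inl rfl)
      · rcases lt_or_gt_of_ne (fun h => ha (h ▸ hx) : x ≠ a) with h | h
        · exact Or.inl ⟨hx, h⟩
        · exact Or.inr (Or.inr ⟨hx, h⟩)
    · rintro (⟨hx, -⟩ | rfl | ⟨hx, -⟩)
      · exact Or.inr hx
      · exact Or.inl rfl
      · exact Or.inr hx

/-! ### A generator times a monomial -/

/-- Moving a generator through a product of `n` generators costs `(-1)ⁿ`. [folklore] -/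
theorem gen_mul_prod_map_gen (a : ι) (l : List ι) :
    gen R a * (l.map (gen R)).prod = ((-1 : R) ^ l.length) • ((l.map (gen R)).prod * gen R a) := by
  induction l with
  | nil => simp
  | cons b l ih =>
    rw [List.map_cons, List.prod_cons, ← mul_assoc, gen_mul_gen, neg_mul, mul_assoc, ih,
      mul_smul_comm, List.length_cons, pow_succ, mul_neg_one, neg_smul, mul_assoc]

variable [Fintype ι]

/-- **A generator times a monomial not containing it**:
`θₐ θ_w = (-1)^{#{b ∈ w | b < a}} θ_{w ∪ {a}}` for `a ∉ w` (the creation-operator action on the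
monomial basis). [folklore] -/
theorem gen_mul_grassmannBasis_of_not_mem {a : ι} {w : Finset ι} (ha : a ∉ w) :
    gen R a * grassmannBasis R ι w =
      ((-1 : R) ^ (w.filter (· < a)).card) • grassmannBasis R ι (insert a w) := by
  rw [grassmannBasis_eq_prod_map_gen, grassmannBasis_eq_prod_map_gen, sort_eq_sort_filter_lt_append w ha,
    sort_insert_eq_append w ha, List.map_append, List.map_append, List.map_cons, List.prod_append,
    List.prod_append, List.prod_cons, ← mul_assoc, gen_mul_prod_map_gen, smul_mul_assoc,
    Finset.length_sort, mul_assoc]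

/-- A generator times a monomial containing it vanishes: `θₐ θ_w = 0` for `a ∈ w`. [folklore] -/
theorem gen_mul_grassmannBasis_of_mem {a : ι} {w : Finset ι} (ha : a ∈ w) :
    gen R a * grassmannBasis R ι w = 0 := by
  have hw : w = insert a (w.erase a) := (Finset.insert_erase ha).symm
  rw [hw, grassmannBasis_eq_prod_map_gen, sort_insert_eq_append _ (Finset.notMem_erase a w),
    List.map_append, List.map_cons, List.prod_append, List.prod_cons, ← mul_assoc,
    gen_mul_prod_map_gen, smul_mul_assoc, mul_assoc, ← mul_assoc (gen R a) (gen R a), gen_mul_self,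
    zero_mul, mul_zero, smul_zero]

/-! ### Products of monomials -/

omit [Fintype ι] in
/-- Sign bookkeeping for `berezinSign` under insertion of a new smallest spectator. [folklore] -/
theorem berezinSign_insert_union {a : ι} {u s : Finset ι} (hau : a ∉ u) (hus : Disjoint (insert a u) s) :
    berezinSign s (insert a u ∪ s) =
      berezinSign s (u ∪ s) * (-1) ^ (s.filter (· < a)).card := by
  have has : a ∉ s := Finset.disjoint_left.1 hus (Finset.mem_insert_self a u)
  have hus' : Disjoint u s := Finset.disjoint_of_subset_left (Finset.subset_insert a u) hus
  have h1 : (insert a u ∪ s) \ s = insert a u := Finset.union_sdiff_cancel_right hus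
  have h2 : (u ∪ s) \ s = u := Finset.union_sdiff_cancel_right hus'
  have hcard : ((s ×ˢ insert a u).filter fun p => p.1 < p.2).card =
      ((s ×ˢ u).filter fun p => p.1 < p.2).card + (s.filter (· < a)).card := by
    rw [Finset.insert_eq, Finset.product_union, Finset.filter_union,
      Finset.card_union_of_disjoint (Finset.disjoint_filter_filter
        (Finset.disjoint_product.2 (Or.inr (Finset.disjoint_singleton_left.2 hau)))),
      add_comm, Finset.product_singleton, Finset.filter_map, Finset.card_map]
    rfl
  rw [berezinSign, berezinSign, h1, h2, hcard]
  exact pow_add _ _ _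

/-- The monomial of `insert a u` for a new smallest element `a` is `θₐ θ_u`. [folklore] -/
theorem grassmannBasis_insert_of_forall_lt {a : ι} {u : Finset ι} (hmin : ∀ x ∈ u, a < x) :
    grassmannBasis R ι (insert a u) = gen R a * grassmannBasis R ι u := by
  have hau : a ∉ u := fun h => lt_irrefl a (hmin a h)
  rw [grassmannBasis_eq_prod_map_gen R (insert a u),
    Finset.sort_insert (r := (· ≤ ·)) (fun b hb => (hmin b hb).le) hau, List.map_cons,
    List.prod_cons, ← grassmannBasis_eq_prod_map_gen]

/-- **Product of two monomials with disjoint supports**: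
`θ_u θ_s = ε θ_{u ∪ s}` with `ε = berezinSign s (u ∪ s) = (-1)^{#{(x, y) ∈ s × u | x < y}}`, the
sign of the shuffle sorting the concatenated increasing enumerations (Berezin 1966, Ch. I §3,
(3.1)–(3.3)). [folklore] -/
theorem grassmannBasis_mul_grassmannBasis_of_disjoint {u s : Finset ι} (h : Disjoint u s) :
    grassmannBasis R ι u * grassmannBasis R ι s =
      (((berezinSign s (u ∪ s) : ℤˣ) : ℤ) : R) • grassmannBasis R ι (u ∪ s) := by
  induction u using Finset.induction_on_min with
  | empty => simp
  | insert a u hmin ih =>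
    have hau : a ∉ u := fun h' => lt_irrefl a (hmin a h')
    have hus : Disjoint u s := Finset.disjoint_of_subset_left (Finset.subset_insert a u) h
    have has : a ∉ s := Finset.disjoint_left.1 h (Finset.mem_insert_self a u)
    have haus : a ∉ u ∪ s := by
      rw [Finset.mem_union, not_or]
      exact ⟨hau, has⟩
    have hfilter : ((u ∪ s).filter (· < a)).card = (s.filter (· < a)).card := by
      congr 1
      ext x
      simp only [Finset.mem_filter, Finset.mem_union]
      constructor
      · rintro ⟨hx | hx, hlt⟩
        · exact absurd hlt (not_lt.2 (hmin x hx).le)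
        · exact ⟨hx, hlt⟩
      · rintro ⟨hx, hlt⟩
        exact ⟨Or.inr hx, hlt⟩
    rw [grassmannBasis_insert_of_forall_lt R hmin, mul_assoc, ih hus, mul_smul_comm,
      gen_mul_grassmannBasis_of_not_mem R haus, smul_smul, berezinSign_insert_union hau h,
      Finset.insert_union, hfilter]
    congr 1
    rw [Units.val_mul, Int.cast_mul]
    congr 1
    norm_cast

/-- Two monomials with overlapping supports multiply to zero. [folklore] -/
theorem grassmannBasis_mul_grassmannBasis_of_not_disjoint {u s : Finset ι} (h : ¬Disjoint u s) :
    grassmannBasis R ι u * grassmannBasis R ι s = 0 := by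
  induction u using Finset.induction_on_min with
  | empty => exact absurd (Finset.disjoint_empty_left s) h
  | insert a u hmin ih =>
    rw [grassmannBasis_insert_of_forall_lt R hmin, mul_assoc]
    by_cases hus : Disjoint u s
    · have has : a ∈ s := by
        by_contra has
        exact h (Finset.disjoint_insert_left.2 ⟨has, hus⟩)
      rw [grassmannBasis_mul_grassmannBasis_of_disjoint R hus, mul_smul_comm,
        gen_mul_grassmannBasis_of_mem R (Finset.mem_union_right u has), smul_zero]
    · rw [ih hus, mul_zero]

/-! ### Partial Berezin integration of a spectator monomial times an integrated monomial -/

/-- **Partial integration of `θ_u θ_m`** for a spectator monomial `θ_u` (`u ∩ s = ∅`) and a monomial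
`θ_m` in the integrated variables (`m ⊆ s`): `∫ dθ_s θ_u θ_m = θ_u` if `m = s` and `0` otherwise
(the sign convention of `berezinOn`, "integrated block to the right", makes this sign-free).
[folklore] -/
theorem berezinOn_grassmannBasis_mul_grassmannBasis {u m s : Finset ι} (hus : Disjoint u s)
    (hms : m ⊆ s) :
    berezinOn R s (grassmannBasis R ι u * grassmannBasis R ι m) =
      if m = s then grassmannBasis R ι u else 0 := by
  have hum : Disjoint u m := Finset.disjoint_of_subset_right hms hus
  rw [grassmannBasis_mul_grassmannBasis_of_disjoint R hum, map_smul, berezinOn_grassmannBasis]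
  by_cases hm : m = s
  · subst hm
    rw [if_pos Finset.subset_union_right, if_pos rfl, Finset.union_sdiff_cancel_right hus, smul_smul,
      ← Int.cast_mul, ← Units.val_mul, Int.units_mul_self, Units.val_one, Int.cast_one, one_smul]
  · have hsub : ¬ s ⊆ u ∪ m := by
      intro hsub
      obtain ⟨x, hxs, hxm⟩ := Finset.exists_of_ssubset (Finset.ssubset_iff_subset_ne.2 ⟨hms, hm⟩)
      rcases Finset.mem_union.1 (hsub hxs) with hxu | hxm'
      · exact Finset.disjoint_left.1 hus hxu hxs
      · exact hxm hxm'
    rw [if_neg hsub, if_neg hm, smul_zero]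

/-! ### The spectator subalgebra and linearity of partial integration over it -/

/-- The **spectator subalgebra** of the variables outside `s`: the `R`-span of the monomials `θ_u`
with `u ∩ s = ∅`, which is the subalgebra generated by the generators `θᵢ`, `i ∉ s`
(`spectatorSubalgebra_eq_adjoin`); its elements are the "coefficients independent of the
integration variables" of Berezin 1966, Ch. I §3 / Salmhofer 1999, Remark B.8. [folklore] -/
def spectatorSubalgebra (s : Finset ι) : Subalgebra R (GrassmannAlgebra R ι) where
  carrier := Submodule.span R (grassmannBasis R ι '' {u | Disjoint u s})
  mul_mem' {a b} ha hb := by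
    have hSS : (grassmannBasis R ι '' {u | Disjoint u s}) * (grassmannBasis R ι '' {u | Disjoint u s}) ⊆
        (Submodule.span R (grassmannBasis R ι '' {u | Disjoint u s}) :
          Set (GrassmannAlgebra R ι)) := by
      rintro _ ⟨_, ⟨u, hu, rfl⟩, _, ⟨v, hv, rfl⟩, rfl⟩
      change grassmannBasis R ι u * grassmannBasis R ι v ∈ _
      by_cases huv : Disjoint u v
      · rw [grassmannBasis_mul_grassmannBasis_of_disjoint R huv]
        exact Submodule.smul_mem _ _
          (Submodule.subset_span ⟨u ∪ v, Finset.disjoint_union_left.2 ⟨hu, hv⟩, rfl⟩)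
      · rw [grassmannBasis_mul_grassmannBasis_of_not_disjoint R huv]
        exact Submodule.zero_mem _
    have h := Submodule.mul_mem_mul ha hb
    rw [Submodule.span_mul_span] at h
    exact Submodule.span_le.2 hSS h
  one_mem' := by
    rw [← grassmannBasis_empty R (ι := ι)]
    exact Submodule.subset_span ⟨∅, Finset.disjoint_empty_left s, rfl⟩
  add_mem' ha hb := Submodule.add_mem _ ha hb
  zero_mem' := Submodule.zero_mem _
  algebraMap_mem' r := by
    rw [Algebra.algebraMap_eq_smul_one, ← grassmannBasis_empty R (ι := ι)]
    exact Submodule.smul_mem _ r (Submodule.subset_span ⟨∅, Finset.disjoint_empty_left s, rfl⟩)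

variable {R}

/-- Membership in the spectator subalgebra is membership in the span of the spectator monomials.
[folklore] -/
theorem mem_spectatorSubalgebra_iff {s : Finset ι} {a : GrassmannAlgebra R ι} :
    a ∈ spectatorSubalgebra R s ↔
      a ∈ Submodule.span R (grassmannBasis R ι '' {u | Disjoint u s}) :=
  Iff.rfl

variable (R)

/-- Spectator monomials belong to the spectator subalgebra. [folklore] -/
theorem grassmannBasis_mem_spectatorSubalgebra {u s : Finset ι} (hu : Disjoint u s) :
    grassmannBasis R ι u ∈ spectatorSubalgebra R s :=
  Submodule.subset_span ⟨u, hu, rfl⟩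

/-- A single generator is the monomial of a singleton. [folklore] -/
theorem grassmannBasis_singleton (i : ι) : grassmannBasis R ι {i} = gen R i := by
  rw [grassmannBasis_eq_prod_map_gen, Finset.sort_singleton, List.map_singleton, List.prod_singleton]

/-- Generators outside `s` are spectators. [folklore] -/
theorem gen_mem_spectatorSubalgebra {s : Finset ι} {i : ι} (hi : i ∉ s) :
    gen R i ∈ spectatorSubalgebra R s := by
  rw [← grassmannBasis_singleton]
  exact grassmannBasis_mem_spectatorSubalgebra R (Finset.disjoint_singleton_left.2 hi)

/-- The spectator subalgebra is generated by the generators outside `s`. [folklore] -/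
theorem spectatorSubalgebra_eq_adjoin (s : Finset ι) :
    spectatorSubalgebra R s = Algebra.adjoin R (gen R '' {i | i ∉ s}) := by
  refine le_antisymm ?_ (Algebra.adjoin_le ?_)
  · intro a ha
    rw [mem_spectatorSubalgebra_iff] at ha
    have h : Submodule.span R (grassmannBasis R ι '' {u | Disjoint u s}) ≤
        Subalgebra.toSubmodule (Algebra.adjoin R (gen R '' {i | i ∉ s})) := by
      refine Submodule.span_le.2 ?_
      rintro _ ⟨u, hu, rfl⟩
      rw [SetLike.mem_coe, Subalgebra.mem_toSubmodule, grassmannBasis_eq_prod_map_gen]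
      refine Subalgebra.list_prod_mem _ fun x hx => ?_
      obtain ⟨i, hi, rfl⟩ := List.mem_map.1 hx
      rw [Finset.mem_sort] at hi
      exact Algebra.subset_adjoin ⟨i, Finset.disjoint_left.1 hu hi, rfl⟩
    exact h ha
  · rintro _ ⟨i, hi, rfl⟩
    exact gen_mem_spectatorSubalgebra R hi

/-- A monomial splits into its spectator part and its part in the integration variables:
`θ_t = ε θ_{t ∖ s} θ_{t ∩ s}`, `ε = berezinSign (t ∩ s) t`. [folklore] -/
theorem grassmannBasis_eq_smul_sdiff_mul_inter (t s : Finset ι) :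
    grassmannBasis R ι t = (((berezinSign (t ∩ s) t : ℤˣ) : ℤ) : R) •
      (grassmannBasis R ι (t \ s) * grassmannBasis R ι (t ∩ s)) := by
  have hd : Disjoint (t \ s) (t ∩ s) :=
    Finset.disjoint_of_subset_right Finset.inter_subset_right Finset.sdiff_disjoint
  rw [grassmannBasis_mul_grassmannBasis_of_disjoint R hd, Finset.sdiff_union_inter, smul_smul,
    ← Int.cast_mul, ← Units.val_mul, Int.units_mul_self, Units.val_one, Int.cast_one, one_smul]

/-- **Partial Berezin integration is linear over the spectator subalgebra** (Berezin 1966,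
Ch. I §3; Salmhofer 1999, App. B, Remark B.8: coefficients "independent of `ψ̄` and `ψ`" pass
through the integral): for `a` in the subalgebra generated by the `θᵢ`, `i ∉ s`, and every `x`,
`∫ dθ_s (a x) = a ∫ dθ_s x` (no sign, the integrated block being moved to the right).
[cite: Salmhofer1999, App. B Remark B.8] -/
theorem berezinOn_mul_of_mem_spectatorSubalgebra {s : Finset ι} {a : GrassmannAlgebra R ι}
    (ha : a ∈ spectatorSubalgebra R s) (x : GrassmannAlgebra R ι) :
    berezinOn R s (a * x) = a * berezinOn R s x := by
  rw [mem_spectatorSubalgebra_iff] at ha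
  induction ha using Submodule.span_induction generalizing x with
  | mem a ha =>
    obtain ⟨u, hu, rfl⟩ := ha
    -- both sides are linear in `x`: check on the monomial basis
    suffices h : berezinOn R s ∘ₗ LinearMap.mulLeft R (grassmannBasis R ι u) =
        LinearMap.mulLeft R (grassmannBasis R ι u) ∘ₗ berezinOn R s from
      LinearMap.congr_fun h x
    refine (grassmannBasis R ι).ext fun t => ?_
    simp only [LinearMap.comp_apply, LinearMap.mulLeft_apply]
    have hv : Disjoint (t \ s) s := Finset.sdiff_disjoint
    have hm : t ∩ s ⊆ s := Finset.inter_subset_right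
    rw [grassmannBasis_eq_smul_sdiff_mul_inter R t s, mul_smul_comm, map_smul, map_smul,
      mul_smul_comm, ← mul_assoc, berezinOn_grassmannBasis_mul_grassmannBasis R hv hm]
    congr 1
    by_cases huv : Disjoint u (t \ s)
    · rw [grassmannBasis_mul_grassmannBasis_of_disjoint R huv, smul_mul_assoc, map_smul,
        berezinOn_grassmannBasis_mul_grassmannBasis R (Finset.disjoint_union_left.2 ⟨hu, hv⟩) hm]
      split_ifs
      · rw [grassmannBasis_mul_grassmannBasis_of_disjoint R huv]
      · rw [smul_zero, mul_zero]
    · rw [grassmannBasis_mul_grassmannBasis_of_not_disjoint R huv, zero_mul, map_zero]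
      split_ifs
      · rw [grassmannBasis_mul_grassmannBasis_of_not_disjoint R huv]
      · rw [mul_zero]
  | zero => rw [zero_mul, map_zero, zero_mul]
  | add a b _ _ iha ihb => rw [add_mul, map_add, iha, ihb, add_mul]
  | smul r a _ ih => rw [smul_mul_assoc, map_smul, ih, smul_mul_assoc]

/-- Central spectators (e.g. even elements) may equally be pulled out on the right. [folklore] -/
theorem berezinOn_mul_of_mem_spectatorSubalgebra_of_commute {s : Finset ι}
    {a : GrassmannAlgebra R ι} (ha : a ∈ spectatorSubalgebra R s) (hc : ∀ z, Commute a z)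
    (x : GrassmannAlgebra R ι) :
    berezinOn R s (x * a) = berezinOn R s x * a := by
  rw [← (hc x).eq, berezinOn_mul_of_mem_spectatorSubalgebra R ha, (hc _).eq]

/-- **Partial integration picks the top coefficient**: for a spectator `a`,
`∫ dθ_s (a θ_s) = a` (Berezin 1966, Ch. I §3, (3.4)–(3.5); Montvay–Münster (4.21)). [folklore] -/
theorem berezinOn_mul_grassmannBasis_self {s : Finset ι} {a : GrassmannAlgebra R ι}
    (ha : a ∈ spectatorSubalgebra R s) : berezinOn R s (a * grassmannBasis R ι s) = a := by
  rw [berezinOn_mul_of_mem_spectatorSubalgebra R ha, berezinOn_grassmannBasis, if_pos subset_rfl,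
    berezinSign_self, Finset.sdiff_self, grassmannBasis_empty, Units.val_one, Int.cast_one, one_smul,
    mul_one]

/-- **Partial integration kills spectators**: `∫ dθ_s a = 0` for a spectator `a` and `s ≠ ∅`
(Berezin 1966, (3.4): `∫ dθᵢ 1 = 0`). [folklore] -/
theorem berezinOn_of_mem_spectatorSubalgebra {s : Finset ι} {a : GrassmannAlgebra R ι}
    (ha : a ∈ spectatorSubalgebra R s) (hs : s.Nonempty) : berezinOn R s a = 0 := by
  rw [← mul_one a, berezinOn_mul_of_mem_spectatorSubalgebra R ha, ← grassmannBasis_empty R (ι := ι),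
    berezinOn_grassmannBasis, if_neg (fun h => ?_), mul_zero]
  exact Finset.not_nonempty_empty (Finset.subset_empty.1 h ▸ hs)

/-! ### Fubini for partial Berezin integration -/

omit [Fintype ι] in
/-- The sign `berezinSign s t` as an element of `R`: `(-1)^{#{(x, y) ∈ s × (t ∖ s) | x < y}}`.
[folklore] -/
theorem intCast_berezinSign (s t : Finset ι) :
    (((berezinSign s t : ℤˣ) : ℤ) : R) =
      (-1 : R) ^ ((s ×ˢ (t \ s)).filter fun p => p.1 < p.2).card := by
  rw [berezinSign]
  norm_cast

omit R [Fintype ι] in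
/-- Exponent bookkeeping for Fubini: with `rest = w ∖ (s ∪ t)`, `s ⊆ w ∖ t`, `s ∩ t = ∅`,
`#{t < (w∖t)} + #{s < rest} = #{t < s} + #{(s ∪ t) < rest}` (pairs `(x, y)` with `x < y`).
[folklore] -/
theorem card_filter_fubini {s t w : Finset ι} (hst : Disjoint s t) (hsw : s ⊆ w \ t) :
    ((t ×ˢ (w \ t)).filter fun p => p.1 < p.2).card +
        ((s ×ˢ ((w \ t) \ s)).filter fun p => p.1 < p.2).card =
      ((t ×ˢ ((s ∪ t) \ t)).filter fun p => p.1 < p.2).card +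
        (((s ∪ t) ×ˢ (w \ (s ∪ t))).filter fun p => p.1 < p.2).card := by
  have h1 : (s ∪ t) \ t = s := Finset.union_sdiff_cancel_right hst
  have h2 : (w \ t) \ s = w \ (s ∪ t) := by rw [sdiff_sdiff_left, Finset.union_comm]; rfl
  have h3 : w \ t = s ∪ (w \ (s ∪ t)) := by rw [← h2, Finset.union_sdiff_of_subset hsw]
  have hd1 : Disjoint s (w \ (s ∪ t)) :=
    Finset.disjoint_left.2 fun x hxs hxw => (Finset.mem_sdiff.1 hxw).2 (Finset.mem_union_left t hxs)
  rw [h1, h2, h3, Finset.product_union, Finset.filter_union,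
    Finset.card_union_of_disjoint (Finset.disjoint_filter_filter
      (Finset.disjoint_product.2 (Or.inr hd1))),
    Finset.union_product, Finset.filter_union,
    Finset.card_union_of_disjoint (Finset.disjoint_filter_filter
      (Finset.disjoint_product.2 (Or.inl hst)))]
  omega

/-- **Fubini for partial Berezin integration**: for disjoint blocks `s`, `t`,
`∫ dθ_s (∫ dθ_t x) = ε ∫ dθ_{s ∪ t} x` with the constant sign `ε = berezinSign t (s ∪ t)
= (-1)^{#{(x, y) ∈ t × s | x < y}}`; in particular `ε = 1` when every element of `s` precedes every
element of `t` (integrate the later block first) (Berezin 1966, Ch. I §3: the multiple integral as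
an iterated one). [folklore] -/
theorem berezinOn_berezinOn {s t : Finset ι} (hst : Disjoint s t) (x : GrassmannAlgebra R ι) :
    berezinOn R s (berezinOn R t x) =
      (((berezinSign t (s ∪ t) : ℤˣ) : ℤ) : R) • berezinOn R (s ∪ t) x := by
  suffices h : berezinOn R s ∘ₗ berezinOn R t =
      (((berezinSign t (s ∪ t) : ℤˣ) : ℤ) : R) • berezinOn R (s ∪ t) from
    LinearMap.congr_fun h x
  refine (grassmannBasis R ι).ext fun w => ?_
  rw [LinearMap.comp_apply, LinearMap.smul_apply, berezinOn_grassmannBasis,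
    berezinOn_grassmannBasis R (s ∪ t)]
  by_cases htw : t ⊆ w
  · rw [if_pos htw, map_smul, berezinOn_grassmannBasis]
    by_cases hsw : s ⊆ w \ t
    · have hstw : s ∪ t ⊆ w := Finset.union_subset (hsw.trans Finset.sdiff_subset) htw
      have hww : (w \ t) \ s = w \ (s ∪ t) := by rw [sdiff_sdiff_left, Finset.union_comm]; rfl
      rw [if_pos hsw, if_pos hstw, smul_smul, smul_smul, hww]
      congr 1
      rw [intCast_berezinSign, intCast_berezinSign, intCast_berezinSign, intCast_berezinSign,
        ← pow_add, ← pow_add, ← card_filter_fubini hst hsw, add_comm]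
    · have hstw : ¬ s ∪ t ⊆ w := by
        intro h
        refine hsw fun y hy => Finset.mem_sdiff.2 ⟨h (Finset.mem_union_left t hy), ?_⟩
        exact Finset.disjoint_left.1 hst hy
      rw [if_neg hsw, if_neg hstw, smul_zero, smul_zero]
  · have hstw : ¬ s ∪ t ⊆ w := fun h => htw (Finset.subset_union_right.trans h)
    rw [if_neg htw, map_zero, if_neg hstw, smul_zero]

/-- Fubini without sign: if every element of `s` precedes every element of `t`, then
`∫ dθ_s ∫ dθ_t = ∫ dθ_{s ∪ t}`. [folklore] -/
theorem berezinOn_berezinOn_of_forall_lt {s t : Finset ι} (h : ∀ x ∈ s, ∀ y ∈ t, x < y)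
    (x : GrassmannAlgebra R ι) :
    berezinOn R s (berezinOn R t x) = berezinOn R (s ∪ t) x := by
  have hst : Disjoint s t := Finset.disjoint_left.2 fun a has hat => lt_irrefl a (h a has a hat)
  have h0 : ((t ×ˢ ((s ∪ t) \ t)).filter fun p => p.1 < p.2) = ∅ := by
    refine Finset.filter_false_of_mem fun p hp => ?_
    obtain ⟨hx, hy⟩ := Finset.mem_product.1 hp
    rw [Finset.union_sdiff_cancel_right hst] at hy
    exact not_lt.2 (h p.2 hy p.1 hx).le
  rw [berezinOn_berezinOn R hst, intCast_berezinSign, h0, Finset.card_empty, pow_zero, one_smul]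

/-- **The full Berezin integral as an iterated one**: for `s` preceding its complement,
`∫ dθ x = ∫ dθ_s (∫ dθ_{sᶜ} x)` (as a multiple of `1`). [folklore] -/
theorem berezinOn_berezinOn_compl_of_forall_lt {s : Finset ι} (h : ∀ x ∈ s, ∀ y ∉ s, x < y)
    (x : GrassmannAlgebra R ι) :
    berezinOn R s (berezinOn R sᶜ x) = algebraMap R (GrassmannAlgebra R ι) (berezin R ι x) := by
  rw [berezinOn_berezinOn_of_forall_lt R (fun a ha b hb => h a ha b (Finset.mem_compl.1 hb)),
    Finset.union_compl, berezinOn_univ_holds]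

end GrassmannAlgebra

end QLatticeAQFT

end Literature.MathematicalPhysics.QuantumLattice
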